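import Summits.CriticalPhenomena.PercolationContinuityZ3.Theorems.SahiCMTP2Maps

/-!
# Fuchs–Wang's replacement theorem (Thm. 2.3) for the density-free notion (5.1), in the paper's coordinates

Support file of the Sahi cell (`prim-sahi`, typer seat, generation 18; `--supports stmt-CriticalPhenomena-4575`).
Theorems only (no definitions, no named facts, no sorries).

[FuchsWang2026] Thm. 2.3: "`cMTP₂(X_B|X_A)` implies `cMTP₂(X_{B∪{k}}|X_{A∖{k}})`" (hence Fig. 1.1's chain from `|B| = 1` to
`|A| = 1`), proved for the density notion through Lemma A.1.  For the density-free (5.1) and a law `μ` on `ℝ^δ`: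
**`isCMTP2SetAt_mono`** — if `A' ⊆ A` (as predicates, `q ≤ p`) then `cMTP₂^set(X_{Aᶜ}|X_A) ⟹ cMTP₂^set(X_{A'ᶜ}|X_{A'})`.
Proof: the regrouping `ℝ^A ≅ ℝ^{A'} × ℝ^{A∖A'}` is a lattice isomorphism, `ℝ^{A∖A'} × ℝ^{Aᶜ} ≅ ℝ^{A'ᶜ}` an order
isomorphism, so `SahiCMTP2Maps` (block maps + `prodAssoc`) applies, and the composite regrouping is the paper's split at `A'`.

No sorries, no new axioms.
-/

noncomputable section

namespace Summit.CriticalPhenomena.PercolationContinuityZ3.Theorems.SahiCMTP2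

open MeasureTheory Set Function
open Literature.Probability.LatticeModels
open scoped ENNReal

section Replacement

variable {δ : Type*} {p q : δ → Prop}

/-- Splitting the conditioning block `ℝ^A ≅ ℝ^{A'} × ℝ^{A∖A'}` (`A' ⊆ A`). [this work] -/
def splitBlock (hqp : ∀ i, q i → p i) (a : {i // p i} → ℝ) :
    ({i // q i} → ℝ) × ({i // p i ∧ ¬ q i} → ℝ) :=
  (fun i => a ⟨i.1, hqp i.1 i.2⟩, fun i => a ⟨i.1, i.2.1⟩)

/-- Merging `ℝ^{A∖A'} × ℝ^{Aᶜ} ≅ ℝ^{A'ᶜ}`. [this work] -/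
def mergeBlock [DecidablePred p] (rb : ({i // p i ∧ ¬ q i} → ℝ) × ({i // ¬ p i} → ℝ)) :
    {i // ¬ q i} → ℝ :=
  fun i => if h : p i.1 then rb.1 ⟨i.1, h, i.2⟩ else rb.2 ⟨i.1, h⟩

/-- The inverse regrouping `ℝ^{A'ᶜ} → ℝ^{A∖A'} × ℝ^{Aᶜ}`. [this work] -/
def unmergeBlock (hqp : ∀ i, q i → p i) (c : {i // ¬ q i} → ℝ) :
    ({i // p i ∧ ¬ q i} → ℝ) × ({i // ¬ p i} → ℝ) :=
  (fun i => c ⟨i.1, i.2.2⟩, fun i => c ⟨i.1, fun hq => i.2 (hqp i.1 hq)⟩)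

/-- `splitBlock` is measurable. [folklore] -/
theorem measurable_splitBlock (hqp : ∀ i, q i → p i) : Measurable (splitBlock hqp) :=
  (measurable_pi_iff.2 fun _ => measurable_pi_apply _).prodMk (measurable_pi_iff.2 fun _ => measurable_pi_apply _)

/-- `mergeBlock` is measurable. [folklore] -/
theorem measurable_mergeBlock [DecidablePred p] : Measurable (mergeBlock (p := p) (q := q)) := by
  refine measurable_pi_iff.2 fun i => ?_
  by_cases h : p i.1
  · simp only [mergeBlock, dif_pos h]
    exact (measurable_pi_apply _).comp measurable_fst
  · simp only [mergeBlock, dif_neg h]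
    exact (measurable_pi_apply _).comp measurable_snd

/-- `splitBlock` commutes with `⊓`. [folklore] -/
theorem splitBlock_inf (hqp : ∀ i, q i → p i) (a b : {i // p i} → ℝ) :
    splitBlock hqp (a ⊓ b) = splitBlock hqp a ⊓ splitBlock hqp b := rfl

/-- `splitBlock` commutes with `⊔`. [folklore] -/
theorem splitBlock_sup (hqp : ∀ i, q i → p i) (a b : {i // p i} → ℝ) :
    splitBlock hqp (a ⊔ b) = splitBlock hqp a ⊔ splitBlock hqp b := rfl

/-- `mergeBlock ⊣ unmergeBlock` (indeed an order isomorphism). [this work] -/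
theorem gc_mergeBlock [DecidablePred p] (hqp : ∀ i, q i → p i) :
    GaloisConnection (mergeBlock (p := p) (q := q)) (unmergeBlock hqp) := by
  intro rb c
  constructor
  · intro h
    refine ⟨fun i => ?_, fun i => ?_⟩
    · have hi := h ⟨i.1, i.2.2⟩
      simp only [mergeBlock, dif_pos i.2.1] at hi
      exact hi
    · have hi := h ⟨i.1, fun hq => i.2 (hqp i.1 hq)⟩
      simp only [mergeBlock, dif_neg i.2] at hi
      exact hi
  · intro h i
    by_cases hp : p i.1
    · simp only [mergeBlock, dif_pos hp]
      exact h.1 ⟨i.1, hp, i.2⟩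
    · simp only [mergeBlock, dif_neg hp]
      exact h.2 ⟨i.1, hp⟩

/-- The composite regrouping `(split × id) ≫ assoc ≫ (id × merge)` after the split at `A` is the split at `A'`.
[this work] -/
theorem regroup_eq [DecidablePred p] [DecidablePred q] (hqp : ∀ i, q i → p i) (x : δ → ℝ) :
    Prod.map id (mergeBlock (p := p) (q := q)) (MeasurableEquiv.prodAssoc
      (Prod.map (splitBlock hqp) id (MeasurableEquiv.piEquivPiSubtypeProd (fun _ : δ => ℝ) p x))) =
      MeasurableEquiv.piEquivPiSubtypeProd (fun _ : δ => ℝ) q x := by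
  refine Prod.ext rfl (funext fun i => ?_)
  simp only [MeasurableEquiv.piEquivPiSubtypeProd_apply, MeasurableEquiv.prodAssoc, MeasurableEquiv.coe_mk,
    Equiv.prodAssoc_apply, Prod.map_fst, Prod.map_snd, id_eq, splitBlock, mergeBlock]
  by_cases h : p i.1
  · rw [dif_pos h]
  · rw [dif_neg h]

/-- **[FuchsWang2026] Thm. 2.3 (replacement), density-free, in the paper's coordinates**: for a finite-dimensional law
`μ` on `ℝ^δ` and `A' ⊆ A`, `cMTP₂^set(X_{Aᶜ} | X_A) ⟹ cMTP₂^set(X_{A'ᶜ} | X_{A'})` — moving coordinates from the conditioning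
block to the conditioned block preserves (5.1) (Fig. 1.1's chain from `|B| = 1` down to `|A| = 1`). [this work] -/
theorem isCMTP2SetAt_mono [Fintype δ] [DecidablePred p] [DecidablePred q] (hqp : ∀ i, q i → p i)
    {μ : Measure (δ → ℝ)} (h : IsCMTP2SetAt p μ) : IsCMTP2SetAt q μ := by
  unfold IsCMTP2SetAt at h ⊢
  have h1 := isCMTP2Set_map_prodMap h (measurable_splitBlock hqp) (splitBlock_inf hqp) (splitBlock_sup hqp)
    measurable_id (χ := id) GaloisConnection.id
  have h2 := isCMTP2Set_map_prodAssoc h1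
  have h3 := isCMTP2Set_map_prodMap h2 measurable_id (fun _ _ => rfl) (fun _ _ => rfl)
    (measurable_mergeBlock (p := p) (q := q)) (gc_mergeBlock hqp)
  have hm1 : Measurable (Prod.map (splitBlock hqp) (id : ({i // ¬ p i} → ℝ) → ({i // ¬ p i} → ℝ))) :=
    (measurable_splitBlock hqp).prodMap measurable_id
  have hm3 : Measurable (Prod.map (id : ({i // q i} → ℝ) → ({i // q i} → ℝ)) (mergeBlock (p := p) (q := q))) :=
    measurable_id.prodMap measurable_mergeBlock
  rw [Measure.map_map (MeasurableEquiv.measurable _) hm1, Measure.map_map hm3 ((MeasurableEquiv.measurable _).comp hm1),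
    Measure.map_map (hm3.comp ((MeasurableEquiv.measurable _).comp hm1)) (MeasurableEquiv.measurable _)] at h3
  have hcomp : (Prod.map id (mergeBlock (p := p) (q := q)) ∘
      (⇑MeasurableEquiv.prodAssoc ∘ Prod.map (splitBlock hqp) id)) ∘
      ⇑(MeasurableEquiv.piEquivPiSubtypeProd (fun _ : δ => ℝ) p) =
        ⇑(MeasurableEquiv.piEquivPiSubtypeProd (fun _ : δ => ℝ) q) :=
    funext fun x => regroup_eq hqp x
  rwa [hcomp] at h3

end Replacement

end Summit.CriticalPhenomena.PercolationContinuityZ3.Theorems.SahiCMTP2
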